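import Mathlib.NumberTheory.LegendreSymbol.JacobiSymbol
import Mathlib.Tactic.NormNum.LegendreSymbol
import Mathlib.LinearAlgebra.Matrix.Rank
import Mathlib.FieldTheory.Finiteness
import Literature.NumberTheory.EllipticCurves.Smith2016.CongruentNumberBSDSelmerRankTwo
import Literature.NumberTheory.EllipticCurves.Smith2016.CongruentNumberBSDSelmerRankTwoProofs
import HarnessLib

/-!
# Monsky's matrix for the `2`-Selmer rank of `E_D : y² = x³ − D²x` (appendix to Heath-Brown, Invent. Math. 118 (1994)) AS PRINTED

HONEST FRAMING (cell `b2b-bsdres`, sub-lane `bsd-p2`, Monsky sub-cell `p2/monsky/`, literature seat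
`p2-monsky-lit`, ask M-L1(a) of `p2/monsky/KICKOFF.md`): this file vendors ONE published theorem
(in its two printed cases, odd and even `D`) as named `Prop`s — nothing asserted, nothing discharged
(D-0014) — together with the COMPUTABLE matrices it speaks about (definitions with bodies) and a few
PROVED pieces of linear-algebra bookkeeping. It is the printed SPEC of the sub-cell's `𝔽₂`-engine
("ENGINE M") and the kernel-decidable certificate shape for the hypothesis `#Sel₂(E_n) = 4` of
`Smith2016.cor13_bsd_of_selmerRankTwo`; it is EVIDENCE of what print says, not a claim about any
class of the census; nothing booked; no mark moved.

Source. D. R. Heath-Brown, *The size of Selmer groups for the congruent number problem, II*, with an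
appendix by P. Monsky, Invent. Math. **118** (1994), 331–370 [HeathBrown1994SelmerCongruentII].
Text read: the open-access author typescript materialised as
`paper:heathbrown1994-size-selmer-groups-congruent-number-problem-ii` (42 pages numbered 1–42;
Monsky's appendix = typescript pp. 38–42, the last five pages of the article; locators `pNNNN Lnn`
below are typescript page / line of that materialisation; the journal pagination 331–370 is not
carried by the held copy).

## The printed statements (verbatim)

* Heath-Brown §1 (p0001 L14–L20): "We are concerned in particular with the “full 2-descent”. The
  number of 2-descents is the order of the Selmer group `S⁽²⁾`. This is a power of 2, and will be a
  multiple of 4, on account of the rational points of order 2 on `E_D`. We shall therefore write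
  `#S⁽²⁾ = 2^{2+s(D)}`. The exponent `s(D)` has sometimes been referred to as the ‘Selmer rank’ of
  the curve `E_D`. Since one has the fundamental inequality `r(D) ≤ s(D)`, …" — with (display (1),
  p0001 L9) `E_D : y² = x³ − D²x`, `D` square-free, `r(D)` its rank.
* Appendix (Monsky), setting (p0038 L17–L37, p0039 L4–L9): `D` positive odd square-free,
  `n = ω(D)` (p0038 L33 — the letter `n` of the appendix is the NUMBER OF PRIME FACTORS; this file
  calls it `k`), `p₁, …, p_n` "the primes dividing `D`" (p0039 L7–L8); "We then produce a `2n × 2n`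
  matrix `M` whose kernel identifies with `K`" where "`K` has size `2^{s(D)}`" (p0039 L1–L3).
* (p0039 L10–L13) "To describe `M` we define `D_j` to be the diagonal `n × n` matrix whose `i`-th
  entry is `0` if `(j/pᵢ) = 1` and is `1` otherwise."
* (p0039 L13–L26) "Moreover we take `A` to be the `n × n` matrix given by `A_ij = 0` if
  `(p_j/p_i) = 1`, `j ≠ i`; `A_ij = 1` if `(p_j/p_i) = −1`, `j ≠ i`, and `A_ii = Σ_{j : j ≠ i} A_ij`."
* (p0039 L27–L33) "Then a little thought shows that one can take
  `M = ( A + D₂  D₂ ; D₂  A + D₋₂ )`. We therefore have `s(D) = 2n − rank(M)`."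
* Even `D` (p0040 L40 – p0041 L44, "a sketch proof for the case in which `D` is positive, even and
  square-free"; `D₀ = D/2`; `A`, `D_j` formed from the primes of `D₀`): (p0041 L20–L26) "one finds
  that `2^{s(D)}` is the size of the kernel of the matrix `M = ( B + D_α  D₋₁ ; D₂  A + D₂ )`";
  (p0041 L27–L36) "Here `B` is defined analogously to `A` except that we have `B_ij = 0` if
  `(q_j/p_i) = 1`, `1` if `(q_j/p_i) = −1`, for `i ≠ j`, where `q_j = ±p_j ≡ 1 (mod 4)`. One now
  finds that `B + D_α = Aᵀ + D₂`, so that `s(D) = 2Ω(D₀) − rank(M₁)`, where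
  `M₁ = ( D₂  A + D₂ ; Aᵀ + D₂  D₋₁ )`."  (`M₁` is `M` with its two block columns interchanged, so
  `rank M₁ = rank M`; we type `M` in the substituted form `( Aᵀ + D₂  D₋₁ ; D₂  A + D₂ )`.)
* The appendix's Theorem (p0038 L6–L7; the parity of `s(D)`: even for `D ≡ 1, 2, 3`, odd for
  `D ≡ 5, 6, 7 (mod 8)`) is NOT vendored here: it is a consequence of the two displays above by the
  printed linear algebra (pp. 39–41), and its `2^∞`-corank form is already the tree's
  `monsky_selmerCorank_two_mod_two_eq` (Monsky 1996). All matrices are over `ℤ/2` ("linear algebra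
  over `ℤ₂^{2n}`", p0039 L4); `rank` is the `𝔽₂`-rank.

## Transcription (tree dictionary)

* `E_D : y² = x³ − D²x` is the tree's `congruentNumberCurve D` (`BSDAnalyticRank`), literally.
* "the Selmer group `S⁽²⁾`" of the full `2`-descent over `ℚ` is the tree's `2`-Selmer group
  `WeierstrassCurve.selmerGroup (congruentNumberCurve D) 2 ⊆ H¹(ℚ, E_D[2])` (`Selmer.lean`), the
  same object as in `Smith2016.cor13_bsd_of_selmerRankTwo`; "`#S⁽²⁾ = 2^{2+s(D)}`" is rendered as
  `Nat.card (selmerGroup … 2) = 2 ^ (2 + s)`.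
* "`p₁, …, p_n` the primes dividing `D`": an injective family `p : Fin k → ℕ` of odd primes with
  `D = ∏ᵢ pᵢ` (odd case) resp. `D = 2 ∏ᵢ pᵢ` (even case); any ordering (the printed statement fixes
  none; a re-ordering conjugates `M` by a permutation matrix and does not change its rank).
  `k = 0` is `D = 1` resp. `D = 2` (empty matrix, `s = 0`; `#Sel₂(E₁) = #Sel₂(E₂) = 4`), which the
  printed hypotheses ("positive odd square-free" / "positive, even and square-free") include.
* "`0` if `(j/pᵢ) = 1` and `1` otherwise": `addLegendreSym j pᵢ : ZMod 2`, built on Mathlib's Jacobi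
  symbol `jacobiSym j pᵢ` (= the Legendre symbol for an odd prime `pᵢ`; `norm_num` evaluates it).
* `A`, `D_j`, `M`: `legendreMatrix p`, `legendreDiagonal p j`, `monskyMatrixOdd p` /
  `monskyMatrixEven p : Matrix (Fin k ⊕ Fin k) (Fin k ⊕ Fin k) (ZMod 2)` (`Matrix.fromBlocks`);
  "`rank(M)`" is Mathlib's `Matrix.rank` over the field `ZMod 2`; "`s(D) = 2n − rank(M)`" is
  `monskySelmerRankOdd p := 2 * k − (monskyMatrixOdd p).rank` (resp. `Even`).
No `_holds` is expected here (a full `2`-descent with the local solubility analysis of Heath-Brown's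
first paper, Invent. Math. 111 (1993), Lemma 3 / display (3)); consumers take
`(h : monsky_card_selmerGroup_two_odd)` etc.

## What is PROVED here (bookkeeping, tree/Mathlib theorems only)

* `natCard_ker_mulVecLin_eq` — the two printed readings agree: for a square matrix `M` over `ZMod 2`
  on an index type of size `m`, `#ker M = 2 ^ (m − rank M)` (rank–nullity), so "`2^{s(D)}` is the
  size of the kernel of `M`" (p0039 L1–L9, p0041 L21) and "`s(D) = 2n − rank(M)`" (p0039 L33) say
  the same thing;
* `monskySelmerRankOdd_eq_zero_of_det` (and `…Even…`): `det M = 1` (equivalently `M`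
  invertible) forces `s = 0` — the DECIDABLE shape of the membership test "`s(n) = 0`";
* `card_selmerGroup_two_eq_four_of_det_odd/even` — under the named fact, `det M = 1` gives
  `#Sel₂(E_D) = 4`, i.e. exactly the hypothesis of `Smith2016.cor13_bsd_of_selmerRankTwo`, and
  `bsdTriple_of_monsky_of_smith_odd/even` chain the two named facts to RANK ∧ SHAFIN ∧ LEAD for
  `congruentNumberCurve D` (both facts as explicit hypotheses; nothing asserted);
* (§6, append of 2026-08-22, lead ask M-L1(b)) **the JOURNAL-tier door**: the tree theorem
  `Smith2016.cor13_bsd_of_selmerRankTwo_of_burungaleTian_of_burungaleFlach`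
  (`Smith2016/CongruentNumberBSDSelmerRankTwoProofs.lean`) DISCHARGES Smith's Cor. 1.3 from
  Burungale–Tian, Ann. of Math. 203 (2026) Thm. 1.1 (rank-`0` `2`-converse, `hBT`), Deuring–Hecke
  (`hH`) and Burungale–Flach, Camb. J. Math. 12 (2024) Thm. 1.1 / Cor. 2 (`hBF`): `#Sel₂(E_n) = 4` ⟹
  rank `0` ∧ `Ш(E_n)[2^∞] = 0` ⟹ RANK ∧ SHAFIN ∧ LEAD. Feeding it into §4 gives
  `bsdTriple_of_monsky_of_BT_BF_odd/even` and `forall_bsdp_of_monsky_of_BT_BF_odd/even`: Monsky's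
  fact + `det M = 1` + the three JOURNAL facts ⟹ BSD for `congruentNumberCurve D` at every prime,
  with `Ш[2^∞] = 0` recorded (`Smith2016.primaryComponent_sha_two_eq_bot_of_card_selmerGroup_two`);
  the Smith door of §4 is the parallel preprint path on the same membership `s(D) = 0`;
* a showcase: `monskyMatrixOdd ![3]` has determinant `1` (`(2/3) = −1`, `(−2/3) = +1`:
  `M = (1 1; 1 0)`), whence `s(3) = 0` and, modulo the two named facts, the BSD triple for
  `y² = x³ − 9x` (`bsdTriple_congruentNumberCurve_three`), exactly as `LiLiuTian2024`'s `n = 5, 13`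
  close modulo one fact.

## References
* [HeathBrown1994SelmerCongruentII] D. R. Heath-Brown, Invent. Math. 118 (1994) 331–370, with an
  appendix by P. Monsky: §1 (typescript p. 1, definition of `s(D)`); appendix pp. 38–42 (odd `D`:
  p. 39 L10–L33; even `D`: p. 41 L20–L36; the Lemma p. 39 L43 – p. 40 L2 and its proof p. 42).
* [Smith2016CongruentDensity] A. Smith, arXiv:1603.08479, Cor. 1.3 and proof of Thm. 1.2 ("Per
  Monsky's calculations in [Heat94], `rk(Sel⁽²⁾(E^{(n)})) = 2 + crnk(M₁)` …", chunk p0005 L64–L68)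
  — the tree's consumer of the hypothesis `#Sel₂ = 4`.
* [SilvermanAEC2009] J. H. Silverman, AEC, Thm. X.4.2 (the `2`-Selmer group; descent inequality).
* [BurungaleTian2026] A. Burungale, Y. Tian, Ann. of Math. (2) 203 (2026) 1–13 = arXiv:2506.03465, Thm. 1.1
  (tree: `burungaleTian_analyticRank_eq_zero_of_selmerCorank_eq_zero_of_hasCM`).
* [BurungaleFlach2024] A. Burungale, M. Flach, Camb. J. Math. 12 (2024) = arXiv:2206.09874, Thm. 1.1, Cor. 2,
  the sentence after Cor. 2 (chunk p0004 L77) and Cor. 3 (tree: `bsdTriple_of_hasCM_of_L_one_ne_zero`; glue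
  `bsdTriple_of_hasCM_of_mordellWeilRank_eq_zero_of_finite_shaPrimary`, `BSDSelmerCMPConverseBSDTripleProofs`).
-/

noncomputable section

open scoped Classical AddSubgroup

open Matrix WeierstrassCurve Literature.NumberTheory.EllipticCurves

namespace Literature.NumberTheory.EllipticCurves.HeathBrown1994

/-! ### §1. The matrices (definitions with bodies; computable data over `ZMod 2`) -/

/-- The additive quadratic symbol of the appendix: "`0` if `(j/pᵢ) = 1` and `1` otherwise"
(p0039 L10–L13; likewise for `A_ij`, L13–L22), as an element of `ℤ/2`; `(j/p)` is Mathlib's Jacobi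
symbol `jacobiSym j p`, the Legendre symbol when `p` is an odd prime.
[cite: HeathBrown1994SelmerCongruentII, Appendix (Monsky), typescript p. 39 L10–L13] -/
def addLegendreSym (a : ℤ) (p : ℕ) : ZMod 2 :=
  if jacobiSym a p = 1 then 0 else 1

/-- Unfolding of `addLegendreSym` (by definition). [cite: HeathBrown1994SelmerCongruentII, Appendix (Monsky), typescript p. 39 L10–L13] -/
theorem addLegendreSym_def (a : ℤ) (p : ℕ) :
    addLegendreSym a p = if jacobiSym a p = 1 then 0 else 1 := rfl

/-- "`0` if `(j/pᵢ) = 1`": the additive symbol vanishes when the Jacobi symbol is `1`.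
[cite: HeathBrown1994SelmerCongruentII, Appendix (Monsky), typescript p. 39 L10–L13] -/
theorem addLegendreSym_of_eq_one {a : ℤ} {p : ℕ} (h : jacobiSym a p = 1) :
    addLegendreSym a p = 0 := by
  simp [addLegendreSym, h]

/-- "and is `1` otherwise": the additive symbol is `1` when the Jacobi symbol is `−1`.
[cite: HeathBrown1994SelmerCongruentII, Appendix (Monsky), typescript p. 39 L10–L13] -/
theorem addLegendreSym_of_eq_neg_one {a : ℤ} {p : ℕ} (h : jacobiSym a p = -1) :
    addLegendreSym a p = 1 := by
  simp [addLegendreSym, h]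

variable {k : ℕ} (p : Fin k → ℕ)

/-- Monsky's matrix `A` (p0039 L13–L26): off the diagonal `A_ij` is the additive symbol of
`(p_j/p_i)`; on the diagonal `A_ii = Σ_{j ≠ i} A_ij` (row sums vanish).
[cite: HeathBrown1994SelmerCongruentII, Appendix (Monsky), typescript p. 39 L13–L26] -/
def legendreMatrix : Matrix (Fin k) (Fin k) (ZMod 2) :=
  Matrix.of fun i j =>
    if i = j then ∑ l ∈ Finset.univ.erase i, addLegendreSym (p l) (p i)
    else addLegendreSym (p j) (p i)

/-- Monsky's diagonal matrix `D_j` (p0039 L10–L13): `i`-th diagonal entry the additive symbol of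
`(j/pᵢ)`; used with `j = 2, −2, −1`.
[cite: HeathBrown1994SelmerCongruentII, Appendix (Monsky), typescript p. 39 L10–L13] -/
def legendreDiagonal (a : ℤ) : Matrix (Fin k) (Fin k) (ZMod 2) :=
  Matrix.diagonal fun i => addLegendreSym a (p i)

/-- **Monsky's matrix for odd `D = p₁⋯p_k`** (p0039 L27–L32):
`M = ( A + D₂  D₂ ; D₂  A + D₋₂ )`, a `2k × 2k` matrix over `ℤ/2` indexed by `Fin k ⊕ Fin k`.
[cite: HeathBrown1994SelmerCongruentII, Appendix (Monsky), typescript p. 39 L27–L32] -/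
def monskyMatrixOdd : Matrix (Fin k ⊕ Fin k) (Fin k ⊕ Fin k) (ZMod 2) :=
  Matrix.fromBlocks (legendreMatrix p + legendreDiagonal p 2) (legendreDiagonal p 2)
    (legendreDiagonal p 2) (legendreMatrix p + legendreDiagonal p (-2))

/-- **Monsky's matrix for even `D = 2p₁⋯p_k`** (p0041 L20–L36, in the printed substituted form
`B + D_α = Aᵀ + D₂`): `M = ( Aᵀ + D₂  D₋₁ ; D₂  A + D₂ )`.
[cite: HeathBrown1994SelmerCongruentII, Appendix (Monsky), typescript p. 41 L20–L36] -/
def monskyMatrixEven : Matrix (Fin k ⊕ Fin k) (Fin k ⊕ Fin k) (ZMod 2) :=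
  Matrix.fromBlocks ((legendreMatrix p)ᵀ + legendreDiagonal p 2) (legendreDiagonal p (-1))
    (legendreDiagonal p 2) (legendreMatrix p + legendreDiagonal p 2)

/-- "`s(D) = 2n − rank(M)`" for odd `D` (p0039 L33), `n = k` the number of prime factors.
[cite: HeathBrown1994SelmerCongruentII, Appendix (Monsky), typescript p. 39 L33] -/
def monskySelmerRankOdd : ℕ :=
  2 * k - (monskyMatrixOdd p).rank

/-- "`s(D) = 2Ω(D₀) − rank(M₁)`" for even `D = 2D₀` (p0041 L36; `rank M₁ = rank M`).
[cite: HeathBrown1994SelmerCongruentII, Appendix (Monsky), typescript p. 41 L36] -/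
def monskySelmerRankEven : ℕ :=
  2 * k - (monskyMatrixEven p).rank

/-! ### §2. The named facts (Monsky's theorem, odd and even case; nothing asserted) -/

/-- **Monsky's theorem, odd case** (appendix to Heath-Brown 1994, typescript p. 39 L10–L33, verbatim
in the module docstring): for `D = p₁⋯p_k` a product of `k` distinct odd primes,
`#Sel₂(E_D/ℚ) = 2^{2 + s(D)}` with `s(D) = 2k − rank_{𝔽₂} M`, `M = ( A + D₂  D₂ ; D₂  A + D₋₂ )`
(`monskyMatrixOdd`), where `E_D : y² = x³ − D²x = congruentNumberCurve D` and `Sel₂` is the tree's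
`2`-Selmer group over `ℚ` (Heath-Brown's "`#S⁽²⁾ = 2^{2+s(D)}`", §1 p. 1 L17–L18). A THEOREM in
print (full `2`-descent), vendored as a named fact; no `_holds` expected.
[cite: HeathBrown1994SelmerCongruentII, Appendix (Monsky), typescript p. 39 L10–L33; §1 p. 1 L14–L20] -/
def monsky_card_selmerGroup_two_odd : Prop :=
  ∀ (k : ℕ) (p : Fin k → ℕ), (∀ i, (p i).Prime) → (∀ i, Odd (p i)) → Function.Injective p →
    Nat.card ((congruentNumberCurve (∏ i, p i)).selmerGroup 2) = 2 ^ (2 + monskySelmerRankOdd p)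

/-- **Monsky's theorem, even case** (appendix to Heath-Brown 1994, typescript p. 41 L20–L36,
verbatim in the module docstring; printed as a "sketch proof"): for `D = 2p₁⋯p_k` with `p₁, …, p_k`
distinct odd primes, `#Sel₂(E_D/ℚ) = 2^{2 + s(D)}` with `s(D) = 2k − rank_{𝔽₂} M`,
`M = ( Aᵀ + D₂  D₋₁ ; D₂  A + D₂ )` (`monskyMatrixEven`; `A`, `D_j` formed from the primes of
`D₀ = D/2`). No `_holds` expected.
[cite: HeathBrown1994SelmerCongruentII, Appendix (Monsky), typescript p. 41 L20–L36; §1 p. 1 L14–L20] -/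
def monsky_card_selmerGroup_two_even : Prop :=
  ∀ (k : ℕ) (p : Fin k → ℕ), (∀ i, (p i).Prime) → (∀ i, Odd (p i)) → Function.Injective p →
    Nat.card ((congruentNumberCurve (2 * ∏ i, p i)).selmerGroup 2) =
      2 ^ (2 + monskySelmerRankEven p)

/-! ### §3. Linear algebra over `𝔽₂` (proved): kernel size versus rank, and the `det = 1` test -/

/-- **The two printed readings agree.** For a square matrix `M` over `ℤ/2` on a finite index type of
size `m`, the kernel of `x ↦ Mx` has `2 ^ (m − rank M)` elements (rank–nullity over the field `𝔽₂`);
so "`2^{s(D)}` is the size of the kernel of `M`" (p0039 L1–L9, p0041 L21) and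
"`s(D) = 2n − rank(M)`" (p0039 L33) coincide. [cite: HeathBrown1994SelmerCongruentII, Appendix (Monsky), typescript p. 39 L1–L9 and L33] -/
theorem natCard_ker_mulVecLin_eq {m : Type*} [Fintype m] [DecidableEq m] (M : Matrix m m (ZMod 2)) :
    Nat.card (LinearMap.ker M.mulVecLin) = 2 ^ (Fintype.card m - M.rank) := by
  have hrn := LinearMap.finrank_range_add_finrank_ker M.mulVecLin
  rw [Module.finrank_pi (ZMod 2)] at hrn
  have hker : Module.finrank (ZMod 2) (LinearMap.ker M.mulVecLin) = Fintype.card m - M.rank := by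
    rw [Matrix.rank]
    omega
  rw [Module.natCard_eq_pow_finrank (K := ZMod 2), Nat.card_zmod, hker]

/-- The rank of a square matrix over `𝔽₂` with determinant `1` is full.
[cite: HeathBrown1994SelmerCongruentII, Appendix (Monsky), typescript p. 39 L33] -/
theorem rank_eq_card_of_det_eq_one {m : Type*} [Fintype m] [DecidableEq m]
    (M : Matrix m m (ZMod 2)) (h : M.det = 1) : M.rank = Fintype.card m :=
  Matrix.rank_of_isUnit M ((Matrix.isUnit_iff_isUnit_det M).mpr (h ▸ isUnit_one))

/-- `det M = 1` forces `s(D) = 2k − rank M = 0` (odd case): the decidable shape of the membership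
test "`s(n) = 0`". [cite: HeathBrown1994SelmerCongruentII, Appendix (Monsky), typescript p. 39 L27–L33] -/
theorem monskySelmerRankOdd_eq_zero_of_det (h : (monskyMatrixOdd p).det = 1) :
    monskySelmerRankOdd p = 0 := by
  rw [monskySelmerRankOdd, rank_eq_card_of_det_eq_one _ h, Fintype.card_sum, Fintype.card_fin]
  omega

/-- `det M = 1` forces `s(D) = 0` (even case). [cite: HeathBrown1994SelmerCongruentII, Appendix (Monsky), typescript p. 41 L20–L36] -/
theorem monskySelmerRankEven_eq_zero_of_det (h : (monskyMatrixEven p).det = 1) :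
    monskySelmerRankEven p = 0 := by
  rw [monskySelmerRankEven, rank_eq_card_of_det_eq_one _ h, Fintype.card_sum, Fintype.card_fin]
  omega

/-! ### §4. Consequences of the named facts (facts as explicit hypotheses; instances discharged) -/

/-- **Odd `D`, `det M = 1` ⟹ `#Sel₂(E_D) = 4`** — under Monsky's theorem, an invertible Monsky
matrix certifies exactly the hypothesis of `Smith2016.cor13_bsd_of_selmerRankTwo` for
`D = p₁⋯p_k`. [cite: HeathBrown1994SelmerCongruentII, Appendix (Monsky), typescript p. 39 L10–L33] -/
theorem card_selmerGroup_two_eq_four_of_det_odd (h : monsky_card_selmerGroup_two_odd)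
    (hp : ∀ i, (p i).Prime) (hodd : ∀ i, Odd (p i)) (hinj : Function.Injective p)
    (hdet : (monskyMatrixOdd p).det = 1) :
    Nat.card ((congruentNumberCurve (∏ i, p i)).selmerGroup 2) = 4 := by
  rw [h k p hp hodd hinj, monskySelmerRankOdd_eq_zero_of_det p hdet]
  norm_num

/-- **Even `D`, `det M = 1` ⟹ `#Sel₂(E_D) = 4`**, `D = 2p₁⋯p_k`.
[cite: HeathBrown1994SelmerCongruentII, Appendix (Monsky), typescript p. 41 L20–L36] -/
theorem card_selmerGroup_two_eq_four_of_det_even (h : monsky_card_selmerGroup_two_even)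
    (hp : ∀ i, (p i).Prime) (hodd : ∀ i, Odd (p i)) (hinj : Function.Injective p)
    (hdet : (monskyMatrixEven p).det = 1) :
    Nat.card ((congruentNumberCurve (2 * ∏ i, p i)).selmerGroup 2) = 4 := by
  rw [h k p hp hodd hinj, monskySelmerRankEven_eq_zero_of_det p hdet]
  norm_num

/-- A product of distinct primes is square-free — the printed setting "`D` is a positive odd
square-free integer", `n = ω(D)`, "`p₁, …, p_n` are the primes dividing `D`" read backwards.
[cite: HeathBrown1994SelmerCongruentII, Appendix (Monsky), typescript p. 38 L17–L33 and p. 39 L7–L8]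
[cite: HardyWright2008, §17.8 (square-free numbers)] -/
theorem squarefree_prod_of_injective (hp : ∀ i, (p i).Prime) (hinj : Function.Injective p) :
    Squarefree (∏ i, p i) :=
  Finset.squarefree_prod_of_pairwise_isCoprime
    (fun i _ j _ hij => Nat.coprime_iff_isRelPrime.mp
      ((Nat.coprime_primes (hp i) (hp j)).mpr fun h => hij (hinj h)))
    fun i _ => (hp i).squarefree

/-- `2 ∏ pᵢ` is square-free for distinct odd primes `pᵢ` — the printed setting "`D` is positive,
even and square-free … `D₀ = D/2`". [cite: HeathBrown1994SelmerCongruentII, Appendix (Monsky), typescript p. 40 L40–L42]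
[cite: HardyWright2008, §17.8 (square-free numbers)] -/
theorem squarefree_two_mul_prod_of_injective (hp : ∀ i, (p i).Prime) (hodd : ∀ i, Odd (p i))
    (hinj : Function.Injective p) : Squarefree (2 * ∏ i, p i) := by
  rw [Nat.squarefree_mul]
  · exact ⟨Nat.prime_two.squarefree, squarefree_prod_of_injective p hp hinj⟩
  · exact Nat.Coprime.prod_right fun i _ =>
      (Nat.coprime_primes Nat.prime_two (hp i)).mpr fun h2 => by
        have := hodd i
        rw [← h2] at this
        exact (Nat.not_odd_iff_even.mpr even_two) this

/-- **The Smith door, odd `D`**: Monsky's theorem (odd case) + Smith 2016 Cor. 1.3, both as explicit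
hypotheses, + an invertible Monsky matrix ⟹ RANK ∧ SHAFIN ∧ LEAD (`BSDTriple`) for
`congruentNumberCurve (p₁⋯p_k)`, with Mordell–Weil and analytic rank `0` (instances discharged:
`∏ pᵢ` is square-free). [cite: HeathBrown1994SelmerCongruentII, Appendix (Monsky), typescript p. 39 L10–L33]
[cite: Smith2016CongruentDensity, Cor. 1.3 (arXiv:1603.08479 chunk p0003 L39–L44)] -/
theorem bsdTriple_of_monsky_of_smith_odd (hM : monsky_card_selmerGroup_two_odd)
    (hS : Smith2016.cor13_bsd_of_selmerRankTwo) (hp : ∀ i, (p i).Prime) (hodd : ∀ i, Odd (p i))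
    (hinj : Function.Injective p) (hdet : (monskyMatrixOdd p).det = 1) :
    haveI := isElliptic_congruentNumberCurve
      (Squarefree.ne_zero (squarefree_prod_of_injective p hp hinj))
    haveI := isGloballyMinimal_congruentNumberCurve (squarefree_prod_of_injective p hp hinj)
    (congruentNumberCurve (∏ i, p i)).BSDTriple ∧
      (congruentNumberCurve (∏ i, p i)).mordellWeilRank = 0 ∧
      (congruentNumberCurve (∏ i, p i)).analyticRank = 0 :=
  Smith2016.bsdTriple_congruentNumberCurve_of_cor13 hS (squarefree_prod_of_injective p hp hinj)
    (card_selmerGroup_two_eq_four_of_det_odd p hM hp hodd hinj hdet)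

/-- **The Smith door, even `D = 2p₁⋯p_k`**. [cite: HeathBrown1994SelmerCongruentII, Appendix (Monsky), typescript p. 41 L20–L36]
[cite: Smith2016CongruentDensity, Cor. 1.3 (arXiv:1603.08479 chunk p0003 L39–L44)] -/
theorem bsdTriple_of_monsky_of_smith_even (hM : monsky_card_selmerGroup_two_even)
    (hS : Smith2016.cor13_bsd_of_selmerRankTwo) (hp : ∀ i, (p i).Prime) (hodd : ∀ i, Odd (p i))
    (hinj : Function.Injective p) (hdet : (monskyMatrixEven p).det = 1) :
    haveI := isElliptic_congruentNumberCurve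
      (Squarefree.ne_zero (squarefree_two_mul_prod_of_injective p hp hodd hinj))
    haveI := isGloballyMinimal_congruentNumberCurve
      (squarefree_two_mul_prod_of_injective p hp hodd hinj)
    (congruentNumberCurve (2 * ∏ i, p i)).BSDTriple ∧
      (congruentNumberCurve (2 * ∏ i, p i)).mordellWeilRank = 0 ∧
      (congruentNumberCurve (2 * ∏ i, p i)).analyticRank = 0 :=
  Smith2016.bsdTriple_congruentNumberCurve_of_cor13 hS
    (squarefree_two_mul_prod_of_injective p hp hodd hinj)
    (card_selmerGroup_two_eq_four_of_det_even p hM hp hodd hinj hdet)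

/-! ### §5. Showcase: `D = 3` (`k = 1`, `(2/3) = −1`, `(−2/3) = 1`, `M = (1 1; 1 0)`, `det M = 1`) -/

/-- `(2/3) = −1` (second supplement to quadratic reciprocity: `(2/p) = 1` iff `p ≡ ±1 (mod 8)`).
[cite: IrelandRosen1990, Ch. 5 §1 Prop. 5.1.3] [cite: HeathBrown1994SelmerCongruentII, §1 typescript p. 6 L26–L28] -/
theorem jacobiSym_two_three : jacobiSym 2 3 = -1 := by norm_num

/-- `(−2/3) = +1` (`−2 ≡ 1 (mod 3)` is a square).
[cite: IrelandRosen1990, Ch. 5 §1 (definition of the Legendre symbol)] [cite: HeathBrown1994SelmerCongruentII, §1 typescript p. 6 L26–L28] -/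
theorem jacobiSym_neg_two_three : jacobiSym (-2) 3 = 1 := by norm_num

/-- Monsky's matrix for `D = 3`: `A = (0)`, `D₂ = (1)`, `D₋₂ = (0)`, so `M = ( 1 1 ; 1 0 )`.
[cite: HeathBrown1994SelmerCongruentII, Appendix (Monsky), typescript p. 39 L27–L32; §1 p. 6 L26–L28 ("when D is prime … s(D) … is 0 for D ≡ 3 (mod 8)")] -/
theorem monskyMatrixOdd_three :
    monskyMatrixOdd ![3] = Matrix.fromBlocks 1 1 1 0 := by
  have h2 : addLegendreSym 2 3 = 1 := addLegendreSym_of_eq_neg_one jacobiSym_two_three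
  have hm2 : addLegendreSym (-2) 3 = 0 := addLegendreSym_of_eq_one jacobiSym_neg_two_three
  ext i j
  rcases i with i | i <;> rcases j with j | j <;>
    · obtain rfl : i = 0 := Subsingleton.elim _ _
      obtain rfl : j = 0 := Subsingleton.elim _ _
      simp [monskyMatrixOdd, legendreMatrix, legendreDiagonal, Matrix.fromBlocks, h2, hm2]

/-- `det M = 1` for `D = 3` (so `s(3) = 0`: Heath-Brown p. 6 L26–L28, "`s(D)` … is `0` for
`D ≡ 3 (mod 8)`" when `D` is prime). [cite: HeathBrown1994SelmerCongruentII, §1 typescript p. 6 L26–L28] -/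
theorem det_monskyMatrixOdd_three : (monskyMatrixOdd ![3]).det = 1 := by
  rw [monskyMatrixOdd_three]
  decide

/-- `s(3) = 0` in Monsky's matrix form. [cite: HeathBrown1994SelmerCongruentII, §1 typescript p. 6 L26–L28] -/
theorem monskySelmerRankOdd_three : monskySelmerRankOdd ![3] = 0 :=
  monskySelmerRankOdd_eq_zero_of_det _ det_monskyMatrixOdd_three

/-- **Showcase** (`y² = x³ − 9x`, Cremona `288d?`-class twist `E₃`; nothing asserted): modulo the two
named facts (Monsky odd case, Smith Cor. 1.3), the kernel derives `#Sel₂(E₃) = 4` from `det M = 1`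
and hence RANK ∧ SHAFIN ∧ LEAD with rank `0` for `congruentNumberCurve 3` — the shape in which the
census's 'CLOSED-IN-PRINT' membership `s(n) = 0` becomes a kernel certificate per `n`.
[cite: HeathBrown1994SelmerCongruentII, Appendix (Monsky), typescript p. 39 L10–L33]
[cite: Smith2016CongruentDensity, Cor. 1.3] -/
theorem bsdTriple_congruentNumberCurve_three (hM : monsky_card_selmerGroup_two_odd)
    (hS : Smith2016.cor13_bsd_of_selmerRankTwo) :
    haveI := isElliptic_congruentNumberCurve (n := 3) (by norm_num)
    haveI := isGloballyMinimal_congruentNumberCurve (n := 3) Nat.prime_three.squarefree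
    (congruentNumberCurve 3).BSDTriple ∧ (congruentNumberCurve 3).mordellWeilRank = 0 ∧
      (congruentNumberCurve 3).analyticRank = 0 := by
  have hprod : (∏ i, (![3] : Fin 1 → ℕ) i) = 3 := by simp
  have h := bsdTriple_of_monsky_of_smith_odd ![3] hM hS (fun i => by
      fin_cases i; exact Nat.prime_three) (fun i => by fin_cases i; exact Nat.odd_iff.mpr rfl)
    (Function.injective_of_subsingleton _) det_monskyMatrixOdd_three
  simp only [hprod] at h
  convert h using 2

/-! ### §6. The journal-tier door: Monsky + `det M = 1` ⟹ BSD via Burungale–Tian 2026 + Burungale–Flach 2024 (through the tree's discharge of Smith's Cor. 1.3 from these facts) -/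

/-- **Journal door, odd `D = p₁⋯p_k`, from Monsky's matrix**: Monsky's fact (odd case) + an
invertible Monsky matrix (`det M = 1`, decidable) + Burungale–Tian 2026 Thm. 1.1 (`hBT`, the
rank-zero `2`-converse for CM curves), Deuring–Hecke (`hH`) and Burungale–Flach 2024 Thm. 1.1 /
Cor. 2 (`hBF`) — all as the tree's named facts, explicit binders — ⟹ RANK ∧ SHAFIN ∧ LEAD for
`congruentNumberCurve (∏ pᵢ)` with Mordell–Weil and analytic rank `0` and `Ш[2^∞] = 0`. The three
journal facts discharge Smith's Cor. 1.3 (`Smith2016.cor13_bsd_of_selmerRankTwo_of_burungaleTian_of_burungaleFlach`),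
so this is §4's door with the preprint input replaced by refereed ones; nothing asserted.
[cite: HeathBrown1994SelmerCongruentII, Appendix (Monsky), typescript p. 39 L10–L33]
[cite: BurungaleTian2026, Thm. 1.1 (arXiv:2506.03465 p0001 L37–L40; applied at p = 2 to E^{(n)}, p0002 L23–L27)]
[cite: BurungaleFlach2024, Thm. 1.1, Cor. 2 and the sentence following it (arXiv:2206.09874 chunk p0004 L60–L77), Cor. 3 (L79–L83)] -/
theorem bsdTriple_of_monsky_of_BT_BF_odd (hM : monsky_card_selmerGroup_two_odd)
    (hBT : burungaleTian_analyticRank_eq_zero_of_selmerCorank_eq_zero_of_hasCM)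
    (hH : hasEntireLFunction_of_j_mem_maximalCMJInvariants)
    (hBF : bsdTriple_of_hasCM_of_L_one_ne_zero) (hp : ∀ i, (p i).Prime) (hodd : ∀ i, Odd (p i))
    (hinj : Function.Injective p) (hdet : (monskyMatrixOdd p).det = 1) :
    haveI := isElliptic_congruentNumberCurve
      (Squarefree.ne_zero (squarefree_prod_of_injective p hp hinj))
    haveI := isGloballyMinimal_congruentNumberCurve (squarefree_prod_of_injective p hp hinj)
    ((congruentNumberCurve (∏ i, p i)).BSDTriple ∧
      (congruentNumberCurve (∏ i, p i)).mordellWeilRank = 0 ∧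
      (congruentNumberCurve (∏ i, p i)).analyticRank = 0) ∧
      AddCommGroup.primaryComponent (congruentNumberCurve (∏ i, p i)).sha 2 = ⊥ :=
  ⟨bsdTriple_of_monsky_of_smith_odd p hM
      (Smith2016.cor13_bsd_of_selmerRankTwo_of_burungaleTian_of_burungaleFlach hBT hH hBF)
      hp hodd hinj hdet,
    Smith2016.primaryComponent_sha_two_eq_bot_of_card_selmerGroup_two
      (Squarefree.ne_zero (squarefree_prod_of_injective p hp hinj))
      (card_selmerGroup_two_eq_four_of_det_odd p hM hp hodd hinj hdet)⟩

/-- **Journal door, even `D = 2p₁⋯p_k`, from Monsky's matrix** (as the odd case).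
[cite: HeathBrown1994SelmerCongruentII, Appendix (Monsky), typescript p. 41 L20–L36]
[cite: BurungaleTian2026, Thm. 1.1] [cite: BurungaleFlach2024, Thm. 1.1 and Cor. 2] -/
theorem bsdTriple_of_monsky_of_BT_BF_even (hM : monsky_card_selmerGroup_two_even)
    (hBT : burungaleTian_analyticRank_eq_zero_of_selmerCorank_eq_zero_of_hasCM)
    (hH : hasEntireLFunction_of_j_mem_maximalCMJInvariants)
    (hBF : bsdTriple_of_hasCM_of_L_one_ne_zero) (hp : ∀ i, (p i).Prime) (hodd : ∀ i, Odd (p i))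
    (hinj : Function.Injective p) (hdet : (monskyMatrixEven p).det = 1) :
    haveI := isElliptic_congruentNumberCurve
      (Squarefree.ne_zero (squarefree_two_mul_prod_of_injective p hp hodd hinj))
    haveI := isGloballyMinimal_congruentNumberCurve
      (squarefree_two_mul_prod_of_injective p hp hodd hinj)
    ((congruentNumberCurve (2 * ∏ i, p i)).BSDTriple ∧
      (congruentNumberCurve (2 * ∏ i, p i)).mordellWeilRank = 0 ∧
      (congruentNumberCurve (2 * ∏ i, p i)).analyticRank = 0) ∧
      AddCommGroup.primaryComponent (congruentNumberCurve (2 * ∏ i, p i)).sha 2 = ⊥ :=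
  ⟨bsdTriple_of_monsky_of_smith_even p hM
      (Smith2016.cor13_bsd_of_selmerRankTwo_of_burungaleTian_of_burungaleFlach hBT hH hBF)
      hp hodd hinj hdet,
    Smith2016.primaryComponent_sha_two_eq_bot_of_card_selmerGroup_two
      (Squarefree.ne_zero (squarefree_two_mul_prod_of_injective p hp hodd hinj))
      (card_selmerGroup_two_eq_four_of_det_even p hM hp hodd hinj hdet)⟩

/-- **`BSD(E_D, ℓ)` for every prime `ℓ` on the journal door** (Miller's `BSDp`, in particular
`ℓ = 2`, the sub-lane's predicate of record), odd `D`, via the tree's `forall_bsdp_of_bsdTriple'`.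
[cite: BurungaleTian2026, Thm. 1.1] [cite: BurungaleFlach2024, Thm. 1.1 and Cor. 2]
[cite: Miller2011LMS, §1 and Def. 1.1] -/
theorem forall_bsdp_of_monsky_of_BT_BF_odd (hM : monsky_card_selmerGroup_two_odd)
    (hBT : burungaleTian_analyticRank_eq_zero_of_selmerCorank_eq_zero_of_hasCM)
    (hH : hasEntireLFunction_of_j_mem_maximalCMJInvariants)
    (hBF : bsdTriple_of_hasCM_of_L_one_ne_zero) (hp : ∀ i, (p i).Prime) (hodd : ∀ i, Odd (p i))
    (hinj : Function.Injective p) (hdet : (monskyMatrixOdd p).det = 1) (ℓ : ℕ) (hℓ : ℓ.Prime) :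
    haveI := isElliptic_congruentNumberCurve
      (Squarefree.ne_zero (squarefree_prod_of_injective p hp hinj))
    haveI := isGloballyMinimal_congruentNumberCurve (squarefree_prod_of_injective p hp hinj)
    BSDp (congruentNumberCurve (∏ i, p i)) ℓ :=
  haveI := isElliptic_congruentNumberCurve
    (Squarefree.ne_zero (squarefree_prod_of_injective p hp hinj))
  haveI := isGloballyMinimal_congruentNumberCurve (squarefree_prod_of_injective p hp hinj)
  forall_bsdp_of_bsdTriple' _
    (bsdTriple_of_monsky_of_BT_BF_odd p hM hBT hH hBF hp hodd hinj hdet).1.1 ℓ hℓ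

/-- **`BSD(E_D, ℓ)` for every prime `ℓ` on the journal door**, even `D`.
[cite: BurungaleTian2026, Thm. 1.1] [cite: BurungaleFlach2024, Thm. 1.1 and Cor. 2]
[cite: Miller2011LMS, §1 and Def. 1.1] -/
theorem forall_bsdp_of_monsky_of_BT_BF_even (hM : monsky_card_selmerGroup_two_even)
    (hBT : burungaleTian_analyticRank_eq_zero_of_selmerCorank_eq_zero_of_hasCM)
    (hH : hasEntireLFunction_of_j_mem_maximalCMJInvariants)
    (hBF : bsdTriple_of_hasCM_of_L_one_ne_zero) (hp : ∀ i, (p i).Prime) (hodd : ∀ i, Odd (p i))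
    (hinj : Function.Injective p) (hdet : (monskyMatrixEven p).det = 1) (ℓ : ℕ) (hℓ : ℓ.Prime) :
    haveI := isElliptic_congruentNumberCurve
      (Squarefree.ne_zero (squarefree_two_mul_prod_of_injective p hp hodd hinj))
    haveI := isGloballyMinimal_congruentNumberCurve
      (squarefree_two_mul_prod_of_injective p hp hodd hinj)
    BSDp (congruentNumberCurve (2 * ∏ i, p i)) ℓ :=
  haveI := isElliptic_congruentNumberCurve
    (Squarefree.ne_zero (squarefree_two_mul_prod_of_injective p hp hodd hinj))
  haveI := isGloballyMinimal_congruentNumberCurve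
    (squarefree_two_mul_prod_of_injective p hp hodd hinj)
  forall_bsdp_of_bsdTriple' _
    (bsdTriple_of_monsky_of_BT_BF_even p hM hBT hH hBF hp hodd hinj hdet).1.1 ℓ hℓ

/-- **Showcase on the journal door**: `y² = x³ − 9x` (`D = 3`, `det M = 1` by `decide`) satisfies
RANK ∧ SHAFIN ∧ LEAD with rank `0` modulo Monsky's fact and the three JOURNAL facts (no preprint
input). [cite: HeathBrown1994SelmerCongruentII, §1 typescript p. 6 L26–L28]
[cite: BurungaleTian2026, Thm. 1.1] [cite: BurungaleFlach2024, Thm. 1.1 and Cor. 2] -/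
theorem bsdTriple_congruentNumberCurve_three_journal (hM : monsky_card_selmerGroup_two_odd)
    (hBT : burungaleTian_analyticRank_eq_zero_of_selmerCorank_eq_zero_of_hasCM)
    (hH : hasEntireLFunction_of_j_mem_maximalCMJInvariants)
    (hBF : bsdTriple_of_hasCM_of_L_one_ne_zero) :
    haveI := isElliptic_congruentNumberCurve (n := 3) (by norm_num)
    haveI := isGloballyMinimal_congruentNumberCurve (n := 3) Nat.prime_three.squarefree
    (congruentNumberCurve 3).BSDTriple ∧ (congruentNumberCurve 3).mordellWeilRank = 0 ∧
      (congruentNumberCurve 3).analyticRank = 0 :=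
  bsdTriple_congruentNumberCurve_three hM
    (Smith2016.cor13_bsd_of_selmerRankTwo_of_burungaleTian_of_burungaleFlach hBT hH hBF)

end Literature.NumberTheory.EllipticCurves.HeathBrown1994

end
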